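import Summits.KontsevichZagierPeriods.KontsevichZagierPeriods.Theses.SpheresForWalls
import Summits.KontsevichZagierPeriods.KontsevichZagierPeriods.Theorems.InverseLandauTateLiftingLogTwoSpin

/-!
# `LogTwoSpin` (stmt-KontsevichZagierPeriods-16461, route SpheresForWalls) — proof

`[D̄ × (1,2), 1/z₂] − [ℝ², ((1+2|w|²)(1+|w|²))⁻¹] ∈ KZ.relations`: every three-dimensional integral
representation with domain `{z₀² + z₁² ≤ 1, 1 < z₂ < 2}` and integrand `1/z₂` on it differs by
relations of the Kontsevich–Zagier calculus from every two-dimensional representation with domain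
`ℝ²` and integrand `((1 + 2(w₀² + w₁²))(1 + (w₀² + w₁²)))⁻¹` (value `π·log 2` on both sides;
calibration 2 of the route). It is verbatim
`Summit.KontsevichZagierPeriods.InverseLandau.tateLifting_logTwoSpin`
(`Theorems/InverseLandauTateLiftingLogTwoSpin.lean`, stub of the line `Sketch` of the crux
`TateLifting`, stmt-KontsevichZagierPeriods-9129, lead c10): the Fubini product `[D̄]·[(1,2), 1/x]`,
the rotation reduction `rotation_reduce` of the spherical side to its meridian times `[D̄]`, and the
dimension-one algebraic-coefficient form of Conjecture 1 (`kzPeriodConjecture_dim_one_algCoeff`) for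
the two `log 2` integrals.
-/

namespace Summit.KontsevichZagierPeriods.SpheresForWalls

/-- **`LogTwoSpin`** (route SpheresForWalls, stmt-KontsevichZagierPeriods-16461): a representation
`[{z₀²+z₁² ≤ 1, 1 < z₂ < 2}, 1/z₂]` and a representation `[ℝ², ((1+2(w₀²+w₁²))(1+(w₀²+w₁²)))⁻¹]`
differ by an element of `KZ.relations`. Proof: `InverseLandau.tateLifting_logTwoSpin`.
[cite: KontsevichZagier2001, §1.2] -/
theorem logTwoSpin_proof :
    Summit.KontsevichZagierPeriods.KontsevichZagierPeriods.Theses.SpheresForWalls.LogTwoSpin :=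
  Summit.KontsevichZagierPeriods.InverseLandau.tateLifting_logTwoSpin

end Summit.KontsevichZagierPeriods.SpheresForWalls
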